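import Mathlib
import Summits.Ventures.PercRepro2.SwOutSevOrbitThm

/-!
# The escaping points of a several-arms block, I (blind cell PercRepro2, night-4 g22,
2026-08-27; proofs/NIGHT4-G22.md §5)

At a non-leaking NON-CORE point `q` (a slab point with a non-uniform arm) of a several-arms base
whose dropped vertices and pieces carry edges leaving the region, the hull of `u` leaves the
region (**`not_hull_u_subset_of_not_core`**): on the T-slab a non-uniform arm is dropped with blue
outside edges (`u`'s blue cluster leaves through them) or with a red piece (through the piece's
blue boundary edge); on the B-slab the mirror with red.  So the non-core points of a block are
ESCAPING points of the class (the base is read off such a point in `SwOutSevEscBase`).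
-/

namespace Summit.Ventures.PercRepro2

namespace MixedArms

open Hull LocRows BigBlock

variable {V : Type*} {E : Type*} [Fintype E] [DecidableEq E]

open scoped Classical

variable {ι ρ ν κ : Type*} {ends : E → Sym2 V} {σ : Config E} {h u : V} {U : ι → Set V}
  {p : ρ → V} {Ah : ν → Set V} {arm : ν → ρ} {F : κ → Set V}

variable (hb : MixedBaseR ends σ h u U p Ah arm F)
include hb

section Esc

variable (hup : ∀ r, ∃ e, ends e = s(u, p r)) {Us : Set V}
  (hext : ∀ r, ∃ e y, ends e = s(p r, y) ∧ y ∉ Us ∧ y ≠ u ∧ ∀ i, y ∉ Ah i)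
  (hpout : ∀ i, ∀ y ∈ Ah i, ∃ e z, ends e = s(y, z) ∧ z ∉ Us ∧ z ≠ h ∧ z ≠ u ∧ (∀ r, z ≠ p r) ∧
    z ∉ armsAllR U Ah F)
  (hdead : ∀ i, ∃ e y, ends e = s(p (arm i), y) ∧ y ∈ Ah i)
include hup hext hpout hdead

omit [Fintype E] [DecidableEq E] in
/-- **At a non-core slab point the hull of `u` leaves the region.** -/
theorem MixedBaseR.not_hull_u_subset_of_not_core {q : PtR ι ρ ν κ} (hq : TSlab q arm ∨ BSlab q arm)
    (hnc : ¬ Core q arm) : ¬ hull ends (mixedRealR ends u U p Ah F σ q) u ⊆ Us := by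
  intro hsub
  set ζ' := mixedRealR ends u U p Ah F σ q with hζ'
  -- the non-uniform arm
  have hne : ∃ r, (q.2.2.1 r ≠ q.2.2.2.1 r) ∨ ∃ i, arm i = r ∧ q.2.1 i ≠ q.2.2.1 r := by
    by_contra hall
    apply hnc
    refine ⟨fun i => ?_, fun r => ?_⟩
    · by_contra hi
      exact hall ⟨arm i, Or.inr ⟨i, rfl, hi⟩⟩
    · by_contra hr
      exact hall ⟨r, Or.inl hr⟩
  obtain ⟨r, hr⟩ := hne
  obtain ⟨e₁, he₁⟩ := hup r
  have hUP₁ : e₁ ∈ clsUPR ends u p r := he₁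
  obtain ⟨e₀, y, he₀, hyU, hyu, hyA⟩ := hext r
  have hX₀ : e₀ ∈ clsExtR ends u p Ah r := ⟨y, he₀, hyu, hyA⟩
  rcases hq with ⟨hs, hT⟩ | ⟨hs, hB⟩
  · -- T-slab: the arm `r` is dropped with blue outside edges or with a red piece
    have huP : q.2.2.1 r = false := by
      cases huP : q.2.2.1 r with
      | false => rfl
      | true =>
        exfalso
        rcases hT r with h' | ⟨ha, he⟩
        · rw [huP] at h'; exact Bool.noConfusion h'
        · rcases hr with hr | ⟨i, hi, hr⟩
          · rw [huP, he] at hr; exact hr rfl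
          · rw [ha i hi, huP] at hr; exact hr rfl
    -- the u–`p r` edge is blue
    have hb₁ : blue ζ' e₁ = true := by
      rw [blue_eq_true_iff, hζ', hb.mixedRealR_apply_UP hUP₁, huP, if_neg (by decide),
        hb.u_red e₁ (p r) he₁]
      rfl
    have hpB : p r ∈ cluster ends (blue ζ') u :=
      mem_cluster_of_edge (mem_cluster_self _ _ _) hb₁ he₁
    rcases hr with hr | ⟨i, hi, hr⟩
    · -- the outside edges are blue
      have he : q.2.2.2.1 r = true := by
        cases he : q.2.2.2.1 r with
        | true => rfl
        | false => rw [huP, he] at hr; exact absurd rfl hr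
      have hb₀ : blue ζ' e₀ = true := by
        rw [blue_eq_true_iff, hζ', hb.mixedRealR_apply_Ext hX₀, he, if_pos rfl,
          hb.ext_blue r e₀ y he₀ hyu hyA]
      exact hyU (hsub (Or.inr (mem_cluster_of_edge hpB hb₀ he₀)))
    · -- a red piece: its dead edge and its boundary edge are blue
      have ha : q.2.1 i = true := by
        cases ha : q.2.1 i with
        | true => rfl
        | false => rw [ha, huP] at hr; exact absurd rfl hr
      obtain ⟨e₂, y₂, he₂, hy₂⟩ := hdead i
      rw [hi] at he₂
      have hA₂ : e₂ ∈ touches ends (Ah i) := MixedBaseR.dead_mem_touches he₂ hy₂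
      have hb₂ : blue ζ' e₂ = true := by
        rw [blue_eq_true_iff, hζ', hb.mixedRealR_apply_Ah hA₂, ha, if_pos rfl,
          hb.dead_blue r e₂ y₂ he₂ ⟨i, hy₂⟩]
      have hy₂B : y₂ ∈ cluster ends (blue ζ') u := mem_cluster_of_edge hpB hb₂ he₂
      obtain ⟨e₃, z, he₃, hzU, hzh, hzu, hzp, hzo⟩ := hpout i y₂ hy₂
      have hA₃ : e₃ ∈ touches ends (Ah i) := ⟨y₂, hy₂, z, he₃⟩
      have hb₃ : blue ζ' e₃ = true := by
        rw [blue_eq_true_iff, hζ', hb.mixedRealR_apply_Ah hA₃, ha, if_pos rfl,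
          hb.bdry_blue e₃ y₂ z he₃ (Or.inl (Or.inr (Set.mem_iUnion.2 ⟨i, hy₂⟩))) hzh hzu hzp hzo]
      exact hzU (hsub (Or.inr (mem_cluster_of_edge hy₂B hb₃ he₃)))
  · -- B-slab: the arm `r` is attached red with red outside edges or with a blue piece
    have huP : q.2.2.1 r = true := by
      cases huP : q.2.2.1 r with
      | true => rfl
      | false =>
        exfalso
        rcases hB r with h' | ⟨ha, he⟩
        · rw [huP] at h'; exact Bool.noConfusion h'
        · rcases hr with hr | ⟨i, hi, hr⟩
          · rw [huP, he] at hr; exact hr rfl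
          · rw [ha i hi, huP] at hr; exact hr rfl
    have hr₁ : ζ' e₁ = true := by
      rw [hζ', hb.mixedRealR_apply_UP hUP₁, huP, if_pos rfl, hb.u_red e₁ (p r) he₁]
    have hpR : p r ∈ cluster ends ζ' u :=
      mem_cluster_of_edge (mem_cluster_self _ _ _) hr₁ he₁
    rcases hr with hr | ⟨i, hi, hr⟩
    · have he : q.2.2.2.1 r = false := by
        cases he : q.2.2.2.1 r with
        | false => rfl
        | true => rw [huP, he] at hr; exact absurd rfl hr
      have hr₀ : ζ' e₀ = true := by
        rw [hζ', hb.mixedRealR_apply_Ext hX₀, he, if_neg (by decide),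
          hb.ext_blue r e₀ y he₀ hyu hyA]
        rfl
      exact hyU (hsub (Or.inl (mem_cluster_of_edge hpR hr₀ he₀)))
    · have ha : q.2.1 i = false := by
        cases ha : q.2.1 i with
        | false => rfl
        | true => rw [ha, huP] at hr; exact absurd rfl hr
      obtain ⟨e₂, y₂, he₂, hy₂⟩ := hdead i
      rw [hi] at he₂
      have hA₂ : e₂ ∈ touches ends (Ah i) := MixedBaseR.dead_mem_touches he₂ hy₂
      have hr₂ : ζ' e₂ = true := by
        rw [hζ', hb.mixedRealR_apply_Ah hA₂, ha, if_neg (by decide),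
          hb.dead_blue r e₂ y₂ he₂ ⟨i, hy₂⟩]
        rfl
      have hy₂R : y₂ ∈ cluster ends ζ' u := mem_cluster_of_edge hpR hr₂ he₂
      obtain ⟨e₃, z, he₃, hzU, hzh, hzu, hzp, hzo⟩ := hpout i y₂ hy₂
      have hA₃ : e₃ ∈ touches ends (Ah i) := ⟨y₂, hy₂, z, he₃⟩
      have hr₃ : ζ' e₃ = true := by
        rw [hζ', hb.mixedRealR_apply_Ah hA₃, ha, if_neg (by decide),
          hb.bdry_blue e₃ y₂ z he₃ (Or.inl (Or.inr (Set.mem_iUnion.2 ⟨i, hy₂⟩))) hzh hzu hzp hzo]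
        rfl
      exact hzU (hsub (Or.inl (mem_cluster_of_edge hy₂R hr₃ he₃)))

end Esc

end MixedArms

end Summit.Ventures.PercRepro2
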